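/-
Origin: expansion seat `planner-pub-hodgecm-mc-period-1-g10-0`, handover #1100 2026-08-19T20:03Z md5 a574f54278a6007a41e8a946986f1729 (NEW additive leaf; (L3) rat_split_level_archInfOf + (L3b) inv_finAdelic_mem_archFinOf for the constructed ιinf/Gfin of #1097; installs after #1097, Junction/LevelSaturation, K-1 twin …Automorphic.UnitaryGroupAwayLevel; bounce drops #1100+#1101) (`HOME/mc/pub-hodgecm-mc-period-1-g10/stage/HodgeCM/Model/ArchSideLevel.lean`, md5 a574f54278a6, 151 lines);
landed by the second packager (p2) in gate run 38 as `HodgeCM/Model/ArchSideLevel.lean` (verbatim).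
-/
/-
Origin: CONSTRUCTION seat `planner-pub-hodgecm-mc-period-1-g10-0` (unit pub-hodgecm-mc-period-1-g10, gen 10 of
mc-period-1, period lane), 2026-08-19.  NEW additive KERNEL leaf `HodgeCM/Model/ArchSideLevel.lean` (node «S-arch»,
finite-level half = theta-3 (L3) `rat_split_level` and (L3b) `fin_mem_Gfin` for the CONSTRUCTED `ιinf` / `Gfin`).
Imports: #1097 `HodgeCM.Model.ArchSideInstance` (`toLatticeModelG`, `archInfOf`, `archFinOf`), discharge-1's
`HodgeCM.Model.Junction.LevelSaturation` (`satLevelOf`, `satLevelRegimeOf`), and the vendored twin of the tree leaf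
`Literature/NumberTheory/Automorphic/UnitaryGroupAwayLevel.lean` (K-1, glue-2).
No proof holes, no hypotheses minted, nothing cited: kernel lemmas only.
Expected `#print axioms`: {propext, Classical.choice, Quot.sound}.
-/
import Summits.HodgeConjecture.HodgeCM.Model.ArchSideInstance
import Summits.HodgeConjecture.HodgeCM.Model.Junction.LevelSaturation
import Literature.NumberTheory.Automorphic.UnitaryGroupAwayLevel

/-!
# The archimedean side at finite level — `rat_split_level` / `fin_mem_Gfin` for the constructed `ιinf`, `Gfin`

`Model/ArchSideInstance` (#1097) constructs the G-side of the theta-space adelic datum over the regime model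
`G := (V.latticeModel printFact_unitaryCompact_holds).G = ↥(regimeSubgroup L V.Hm)`:
`ιinf := archInfOf V : U21 →* G` (the honest section at the place of `ι₁` through `V.sylvesterFrame`) and
`Gfin := archFinOf V` (the away-from-`ι₁` factor), with `comm_fin` and the level-free rational splitting `rat_split`.

The RUN-38 re-cut of `structure ThetaAdelicSide` (theta-3, `Model/ThetaSpaceInputPin`) adds two FIELDS (texts of
record, theta-3 STATUS 2026-08-19T19:30:42Z (Q2)):

* (L3) `rat_split_level : ∀ (hV : IsAnisotropic L V.Hm) (K : Subgroup V.adelicFin) (g : ↥(unitaryGroup c V.Hm)),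
    ((g : GL (Fin 3) L) ∈ UnitaryGroup.arithmeticLevel L⁺ L c 3 V.Hm K) →
      ∃ x : G, x ∈ satLevelRegimeOf V hV K ∧ ιinf (BallRational.toBall L ι₁ V.Hm V.sylvesterFrame _ g) * x ∈ Γ ∧
        ∀ y : U21, Commute x (ιinf y)` — RATIONAL SPLITTING AT FINITE LEVEL `K`: a point of the arithmetic subgroup
  `Γ(K) = U(V)(L⁺) ∩ K`, read in `U(2,1)` through the frame, is corrected INTO `Γ = G_U(L⁺)` by an element of the
  saturation subgroup `satLevelRegimeOf V hV K` (= `Π_{w ≠ w_{ι₁}} U(σ_w V.Hm)(ℂ) × K` in the regime model) which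
  commutes with the whole archimedean component;
* (L3b) `fin_mem_Gfin : ∀ (hV : IsAnisotropic L V.Hm) (kf : V.adelicFin),
    regimeEquiv L V.Hm hV ((cmAdelicProdEquiv L 3 V.Hm).symm (1, kf⁻¹)) ∈ Gfin` — finite-adelic translates lie in the
  away-factor.

This file PROVES both for `ιinf := archInfOf V`, `Gfin := archFinOf V`, with the field types LITERALLY up to the
binder spelling `Subgroup V.adelicFin = Subgroup (finAdelic L⁺ L c 3 V.Hm)` (so that the honest record's field lines
`rat_split_level := rat_split_level_archInfOf V`, `fin_mem_Gfin := inv_finAdelic_mem_archFinOf V` elaborate with no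
cast), from the tree leaf `UnitaryGroupAwayLevel` § 2 (CM case):

* `awayLevelCM_eq_satLevelOf` — the tree's `K`-type subgroup away from `ι₁` at level `K`,
  `awayLevelCM 3 L ι₁ V.Hm K = awayFromCM ⊓ finPart⁻¹ K`, IS discharge-1's saturation subgroup
  `satLevelOf V K = awayFromCM ⊓ cmSplitLevel K` (`(cmAdelicProdEquiv g).2 = finPart g`, `rfl`);
* `rat_split_level_archInfOf` = tree `exists_archSectionU21CM_mul_mem_adelicUnitaryRat_of_mem_arithmeticLevel`
  [BorelJacquet1979 §4.1: `G(𝔸) = G_∞ × G(𝔸_f)`, the diagonal embedding] + `commute_archSectionU21CM_of_mem_awayLevelCM`,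
  transported along `toLatticeModelG V` (= `regimeEquiv` in the regime, #1097 `toRegime_apply_of`; J0(d)/(e) twins);
* `inv_finAdelic_mem_archFinOf` = the adelic point `e⁻¹(1, k_f⁻¹)` is away from `ι₁`
  (tree `finAdelicToAdelic_mem_awayFrom`, `adelicProdEquiv_symm_apply`).

MODEL-N ±0 (kernel).  E is untouched: `S` stays E's data binder; these are the canonical producers of its two new
G-side fields, consumed by `Model/ArchSideOf` r4 (`archSideOf V c …`).
-/

set_option autoImplicit false

noncomputable section

open NumberField
open Literature.Geometry.ComplexHyperbolic.BallModel (U21)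
open Literature.NumberTheory.Automorphic
open Literature.AlgebraicGeometry.ShimuraVarieties

namespace HodgeCM

namespace Model

variable {L : CMField} {ι₁ : L →+* ℂ} (V : HermSpace3 L ι₁)

/-! ### The tree's `awayLevelCM K` is the saturation subgroup `satLevelOf V K` -/

/-- **`awayLevelCM 3 L ι₁ V.Hm K = satLevelOf V K`**: both are `awayFromCM ⊓ {g | g_f ∈ K}`
(`mem_awayLevelCM_iff`, `mem_satLevelOf_iff`, `mem_cmSplitLevel_iff`, and `(cmAdelicProdEquiv g).2 = finPart g` by `rfl`). -/
theorem awayLevelCM_eq_satLevelOf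
    (K : Subgroup (UnitaryGroup.finAdelic (↥(maximalRealSubfield L)) L (IsCMField.complexConj L) 3 V.Hm)) :
    UnitaryGroup.awayLevelCM 3 (L : Type) ι₁ V.Hm K = satLevelOf V K := by
  ext g
  rw [UnitaryGroup.mem_awayLevelCM_iff, mem_satLevelOf_iff, UnitaryGroup.mem_cmSplitLevel_iff]
  exact Iff.rfl

/-- Elements of the saturation subgroup, read in the regime model through `toLatticeModelG V`, lie in
`satLevelRegimeOf V hV K` (#1097 `toLatticeModelG_apply` / `toRegime_apply_of`: `toLatticeModelG V = regimeEquiv` in the regime). -/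
theorem toLatticeModelG_mem_satLevelRegimeOf (hV : IsAnisotropic L V.Hm)
    (K : Subgroup (UnitaryGroup.finAdelic (↥(maximalRealSubfield L)) L (IsCMField.complexConj L) 3 V.Hm))
    {k : ↥(Literature.NumberTheory.Automorphic.adelicUnitaryGroup (L : Type) V.Hm)} (hk : k ∈ satLevelOf V K) :
    toLatticeModelG V k ∈ satLevelRegimeOf V hV K := by
  rw [toLatticeModelG_apply, Adelic.toRegime_apply_of L V.Hm hV]
  exact mem_satLevelRegimeOf_of_mem V hV K hk

/-! ### (L3) rational splitting at finite level, for `ιinf := archInfOf V` -/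

/-- **`rat_split_level`, PROVED for the constructed archimedean component** (theta-3 (L3), field text of record):
for `g` in the arithmetic subgroup `Γ(K)` of level `K` there is `x ∈ satLevelRegimeOf V hV K` with
`archInfOf V (toBall g) * x ∈ Γ` and `x` commuting with every `archInfOf V y` — the tree's rational splitting at level
`K` (`exists_archSectionU21CM_mul_mem_adelicUnitaryRat_of_mem_arithmeticLevel`, [BorelJacquet1979 §4.1]) and
`commute_archSectionU21CM_of_mem_awayLevelCM`, transported by `toLatticeModelG V` (J0(e) `toLatticeModelG_mem_Γ`). -/
theorem rat_split_level_archInfOf (hV : IsAnisotropic L V.Hm)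
    (K : Subgroup (UnitaryGroup.finAdelic (↥(maximalRealSubfield L)) L (IsCMField.complexConj L) 3 V.Hm))
    (g : ↥(unitaryGroup (IsCMField.complexConj L : L →+* L) V.Hm))
    (hg : (g : GL (Fin 3) L) ∈
      UnitaryGroup.arithmeticLevel (↥(maximalRealSubfield L)) L (IsCMField.complexConj L) 3 V.Hm K) :
    ∃ x : (V.latticeModel printFact_unitaryCompact_holds).G,
      x ∈ satLevelRegimeOf V hV K ∧
        archInfOf V (BallRational.toBall L ι₁ V.Hm V.sylvesterFrame (sylvesterFrame_J V) g) * x ∈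
            (V.latticeModel printFact_unitaryCompact_holds).Γ ∧
          ∀ y : U21, Commute x (archInfOf V y) := by
  obtain ⟨k, hk, hmem⟩ :=
    UnitaryGroup.exists_archSectionU21CM_mul_mem_adelicUnitaryRat_of_mem_arithmeticLevel (L : Type) ι₁ V.Hm
      V.sylvesterFrame (sylvesterFrame_J V) K g hg
  refine ⟨toLatticeModelG V k,
    toLatticeModelG_mem_satLevelRegimeOf V hV K ((awayLevelCM_eq_satLevelOf V K).le hk), ?_, ?_⟩
  · rw [archInfOf_apply, ← map_mul]
    exact toLatticeModelG_mem_Γ V hmem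
  · intro y
    rw [archInfOf_apply]
    exact (UnitaryGroup.commute_archSectionU21CM_of_mem_awayLevelCM (L : Type) ι₁ V.Hm V.sylvesterFrame
      (sylvesterFrame_J V) K y hk).map (toLatticeModelG V)

/-! ### (L3b) finite-adelic translates lie in the away-factor, for `Gfin := archFinOf V` -/

/-- **`e⁻¹(1, k_f) ∈ archFinOf V`** (in the regime): the adelic point with archimedean component `1` and finite
component `k_f` is away from the place of `ι₁` (tree `finAdelicToAdelic_mem_awayFrom`, `adelicProdEquiv_symm_apply`
[BorelJacquet1979 §4.1]), and `toLatticeModelG V = regimeEquiv L V.Hm hV` on elements (#1097 `toRegime_apply_of`). -/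
theorem finAdelic_mem_archFinOf (hV : IsAnisotropic L V.Hm)
    (kf : UnitaryGroup.finAdelic (↥(maximalRealSubfield L)) L (IsCMField.complexConj L) 3 V.Hm) :
    HodgeCM.Adelic.regimeEquiv L V.Hm hV ((UnitaryGroup.cmAdelicProdEquiv (L : Type) 3 V.Hm).symm (1, kf)) ∈
      archFinOf V := by
  have h1 : (UnitaryGroup.cmAdelicProdEquiv (L : Type) 3 V.Hm).symm (1, kf) =
      UnitaryGroup.finAdelicToAdelic (↥(maximalRealSubfield L)) (L : Type) (IsCMField.complexConj L) 3 V.Hm kf := by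
    show (UnitaryGroup.adelicProdEquiv _ _ _ _ _).symm (1, kf) = _
    rw [UnitaryGroup.adelicProdEquiv_symm_apply, map_one, one_mul]
  refine (mem_archFinOf_iff V _).2 ⟨(UnitaryGroup.cmAdelicProdEquiv (L : Type) 3 V.Hm).symm (1, kf), ?_, ?_⟩
  · rw [h1]
    exact UnitaryGroup.finAdelicToAdelic_mem_awayFrom (↥(maximalRealSubfield L)) (L : Type) (IsCMField.complexConj L) 3
      V.Hm (IsCMField.complexConj_ne_one L) (complexConj_smul_infinitePlace L) (UnitaryGroup.cmPlace (L : Type) ι₁) kf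
  · rw [toLatticeModelG_apply, Adelic.toRegime_apply_of L V.Hm hV]
    rfl

/-- **`fin_mem_Gfin`, PROVED for the constructed away-factor** (theta-3 (L3b), field text of record):
`regimeEquiv L V.Hm hV (e⁻¹(1, k_f⁻¹)) ∈ archFinOf V` for every finite-adelic `k_f`. -/
theorem inv_finAdelic_mem_archFinOf (hV : IsAnisotropic L V.Hm)
    (kf : UnitaryGroup.finAdelic (↥(maximalRealSubfield L)) L (IsCMField.complexConj L) 3 V.Hm) :
    HodgeCM.Adelic.regimeEquiv L V.Hm hV ((UnitaryGroup.cmAdelicProdEquiv (L : Type) 3 V.Hm).symm (1, kf⁻¹)) ∈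
      archFinOf V :=
  finAdelic_mem_archFinOf V hV kf⁻¹

end Model

end HodgeCM

end
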